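import Mathlib
import HarnessLib

/-!
# Apéry's `ζ(2)` numbers `Σ C(n,k)² C(n+k,k)` and their three-term recurrence

Topic `Literature/Combinatorics/Enumerative` (companion of `AperyNumbers.lean`, which treats the `ζ(3)`
numbers `Σ C(n,k)² C(n+k,k)²`).  The second Apéry sequence

`B_n = Σ_{k=0}^{n} C(n,k)² C(n+k,k) = 1, 3, 19, 147, 1251, 11253, …`

(the denominators of Apéry's approximations to `ζ(2)`) satisfies

`n² B_n = (11n² − 11n + 3) B_{n−1} + (n−1)² B_{n−2}   (n ≥ 2)`,

equivalently `(n+2)² B_{n+2} = (11n² + 33n + 25) B_{n+1} + (n+1)² B_n` (`n ≥ 0`).  We PROVE it by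
creative telescoping with an explicit polynomial certificate (found here by fitting Zeilberger's ansatz
`G = R·F`; the kernel checks the resulting identity for all `n, k`).

## Source, VERBATIM — W. Y. C. Chen, E. X. W. Xia, *The 2-log-convexity of the Apéry numbers*,
Proc. Amer. Math. Soc. 139 (2011) 391–400 = arXiv:0912.0795 [ChenXia2011] (held text
`paper:arxiv-0912.0795`, chunk p0003, §1 Introduction)

«In his proof of the irrationality of `ζ(2)` and `ζ(3)`, Apéry [Apery] introduced the following numbers
`A_n` and `B_n` as given by `A_n = Σ_{k=0}^{n} C(n,k)² C(n+k,k)²`, `B_n = Σ_{k=0}^{n} C(n,k)² C(n+k,k)`.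
The numbers `A_n` and `B_n` are often called the Apéry numbers. It has been shown by Apéry [Apery]
that `A_n` and `B_n` satisfy the following three-term recurrence relations for `n ≥ 2`,
`A_n = (34n³ − 51n² + 27n − 5)/n³ · A_{n−1} − (n−1)³/n³ · A_{n−2}`,   (R-1)
`B_n = (11n² − 11n + 3)/n² · B_{n−1} + (n−1)²/n² · B_{n−2}`,   (R-2)
where `A_0 = 1, A_1 = 5, B_0 = 1, B_1 = 3`; see also [Koepf, Str]. … Note that the recurrence
relations (R-1) and (R-2) can be derived by using Zeilberger's algorithm [Wilf].»

## What is formalised (everything PROVED)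

* `apery2Term n k = C(n,k)² C(n+k,k)`, `apery2Number n = Σ_{k ≤ n} apery2Term n k` (`B_n`), the first
  values `1, 3, 19, 147, 1251` (`apery2Number_zero` … `apery2Number_four`).
* `apery2Cert m j = (j² + 3(2m+1) j − (11m² + 9m + 2)) · C(m,j)² · C(m+j,j)` — a Zeilberger
  certificate `G(n,k) = apery2Cert (n+1) k` for the telescoper `(n+2)² N² − (11n²+33n+25) N − (n+1)²`
  (an integer for all `m, j`, vanishing for `j > m`).
* `apery2Cert_succ_sub` / `apery2Cert_zero` — **the telescoped recurrence**, for all `n k : ℕ`: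
  `apery2Cert (n+1) (k+1) − apery2Cert (n+1) k
     = (n+2)² F(n+2,k+1) − (11n²+33n+25) F(n+1,k+1) − (n+1)² F(n,k+1)`
  and the boundary value `apery2Cert (n+1) 0 = (n+2)² − (11n²+33n+25) − (n+1)²`.
* `apery2_sum_telescoped` — summing over `k` collapses the right-hand side to `apery2Cert (n+1) K`.
* **`apery2Number_rec`** — (R-2) shifted to `n ≥ 0`, subtraction-free in `ℕ`:
  `(n+2)² B_{n+2} = (11n² + 33n + 25) B_{n+1} + (n+1)² B_n`; **`apery2Number_rec_R2`** — (R-2) verbatim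
  (cleared of denominators, in `ℤ`): `n² B_n = (11n² − 11n + 3) B_{n−1} + (n−1)² B_{n−2}` for `n ≥ 2`.

Not covered: (R-1) (it is `AperyNumbers.aperyNumber_rec'`), the log-convexity and 2-log-convexity
theorems of [ChenXia2011], the numerators of Apéry's approximations, `B_n`'s generating function.

Nearest existing declarations (named, not restated): `Literature/Combinatorics/Enumerative/AperyNumbers.lean`
(`aperyNumber_rec`, same method for (R-1)); `Literature/Combinatorics/Enumerative/CreativeTelescoping.lean`
(the *A = B* ch. 6 framework); `Literature/NumberTheory/Transcendental/AperyTable.lean`,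
`BeukersZetaThree*.lean` (Apéry/Beukers irrationality side); the crux sketch
`Summits/KontsevichZagierPeriods/KontsevichZagierPeriods/Cruxes/HoffmanIndependence/Ideator4Sketch.lean`
DEFINES `apery2A` by the recurrence (R-2) (`recPair apery2Step 1 3`) — here the recurrence is a THEOREM about the
binomial sum; Mathlib `Nat.choose_mul_succ_eq`,
`Nat.add_one_mul_choose_eq`, `Nat.choose_succ_right_eq`, `Nat.succ_mul_centralBinom_succ`.
-/

namespace Literature.Combinatorics.Enumerative.AperyNumbersZetaTwo

open Finset

/-! ## Definitions -/

/-- The summand `F(n,k) = C(n,k)² C(n+k,k)` of `B_n`. [cite: ChenXia2011, §1 (definition of B_n)] -/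
def apery2Term (n k : ℕ) : ℕ := n.choose k ^ 2 * (n + k).choose k

/-- Apéry's `ζ(2)` numbers `B_n = Σ_{k=0}^{n} C(n,k)² C(n+k,k)`. [cite: ChenXia2011, §1 (definition of B_n)] -/
def apery2Number (n : ℕ) : ℕ := ∑ k ∈ range (n + 1), apery2Term n k

/-- The telescoper's middle coefficient `11n² + 33n + 25 = 11(n+1)² + 11(n+1) + 3`.
[cite: ChenXia2011, §1 (R-2)] -/
def apery2Mid (n : ℕ) : ℕ := 11 * n ^ 2 + 33 * n + 25

/-- The certificate `G = R·F` of Zeilberger's algorithm for `B_n`, in closed polynomial form: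
`apery2Cert m j = (j² + 3(2m+1) j − (11m² + 9m + 2)) C(m,j)² C(m+j,j)` (so `G(n,k) = apery2Cert (n+1) k`).
[cite: ChenXia2011, §1 (R-2) («can be derived by using Zeilberger's algorithm»)] -/
def apery2Cert (m j : ℕ) : ℤ :=
  (((j : ℤ)) ^ 2 + 3 * (2 * m + 1) * j - (11 * (m : ℤ) ^ 2 + 9 * m + 2)) * ((m.choose j : ℕ) : ℤ) ^ 2
    * (((m + j).choose j : ℕ) : ℤ)

/-! ## First values -/

/-- `B₀ = 1`. [cite: ChenXia2011, §1 (R-2)] -/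
theorem apery2Number_zero : apery2Number 0 = 1 := by decide

/-- `B₁ = 3`. [cite: ChenXia2011, §1 (R-2)] -/
theorem apery2Number_one : apery2Number 1 = 3 := by decide

/-- `B₂ = 19`. [cite: ChenXia2011, §1 (R-2)] -/
theorem apery2Number_two : apery2Number 2 = 19 := by decide

/-- `B₃ = 147`. [cite: ChenXia2011, §1 (R-2)] -/
theorem apery2Number_three : apery2Number 3 = 147 := by
  simp [apery2Number, apery2Term, sum_range_succ, Nat.choose]

/-- `B₄ = 1251`. [cite: ChenXia2011, §1 (R-2)] -/
theorem apery2Number_four : apery2Number 4 = 1251 := by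
  simp [apery2Number, apery2Term, sum_range_succ, Nat.choose]

/-! ## Vanishing outside the support -/

/-- `F(n,k) = 0` for `k > n`. [cite: ChenXia2011, §1 (definition of B_n)] -/
theorem apery2Term_eq_zero {n k : ℕ} (h : n < k) : apery2Term n k = 0 := by
  simp [apery2Term, Nat.choose_eq_zero_of_lt h]

/-- `F(n,0) = 1`. [cite: ChenXia2011, §1 (definition of B_n)] -/
theorem apery2Term_zero (n : ℕ) : apery2Term n 0 = 1 := by
  simp [apery2Term]

/-- The certificate vanishes for `j > m`. [cite: ChenXia2011, §1 (R-2)] -/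
theorem apery2Cert_eq_zero {m j : ℕ} (h : m < j) : apery2Cert m j = 0 := by
  simp [apery2Cert, Nat.choose_eq_zero_of_lt h]

/-! ## The telescoped recurrence -/

/-- The boundary value at `k = 0`: `apery2Cert (n+1) 0 = (n+2)² − (11n²+33n+25) − (n+1)²`.
[cite: ChenXia2011, §1 (R-2)] -/
theorem apery2Cert_zero (n : ℕ) :
    apery2Cert (n + 1) 0 = ((n : ℤ) + 2) ^ 2 * (apery2Term (n + 2) 0 : ℕ)
      - (apery2Mid n : ℕ) * (apery2Term (n + 1) 0 : ℕ) - ((n : ℤ) + 1) ^ 2 * (apery2Term n 0 : ℕ) := by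
  simp only [apery2Cert, apery2Term_zero, apery2Mid, Nat.choose_zero_right, add_zero]
  push_cast
  ring

/-- **The telescoped recurrence**: for all `n k : ℕ`,
`apery2Cert (n+1) (k+1) − apery2Cert (n+1) k = (n+2)² F(n+2,k+1) − (11n²+33n+25) F(n+1,k+1) − (n+1)² F(n,k+1)`.
[cite: ChenXia2011, §1 (R-2)] -/
theorem apery2Cert_succ_sub (n k : ℕ) :
    apery2Cert (n + 1) (k + 1) - apery2Cert (n + 1) k
      = ((n : ℤ) + 2) ^ 2 * (apery2Term (n + 2) (k + 1) : ℕ)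
        - (apery2Mid n : ℕ) * (apery2Term (n + 1) (k + 1) : ℕ)
        - ((n : ℤ) + 1) ^ 2 * (apery2Term n (k + 1) : ℕ) := by
  rcases Nat.lt_or_ge (n + 1) (k + 1) with hlt | hle
  · rcases Nat.lt_or_ge (n + 1) k with hlt' | hle'
    · -- `k ≥ n + 2`: all terms vanish
      have h1 : apery2Cert (n + 1) (k + 1) = 0 := apery2Cert_eq_zero hlt
      have h2 : apery2Cert (n + 1) k = 0 := apery2Cert_eq_zero hlt'
      have h3 : apery2Term (n + 2) (k + 1) = 0 := apery2Term_eq_zero (by omega)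
      have h4 : apery2Term (n + 1) (k + 1) = 0 := apery2Term_eq_zero hlt
      have h5 : apery2Term n (k + 1) = 0 := apery2Term_eq_zero (by omega)
      simp [h1, h2, h3, h4, h5]
    · -- `k = n + 1`: the central-binomial boundary `(n+2) C(2n+4,n+2) = 2(2n+3) C(2n+2,n+1)`
      have hk : k = n + 1 := by omega
      subst hk
      have h1 : apery2Cert (n + 1) (n + 1 + 1) = 0 := apery2Cert_eq_zero (by omega)
      have h4 : apery2Term (n + 1) (n + 1 + 1) = 0 := apery2Term_eq_zero (by omega)
      have h5 : apery2Term n (n + 1 + 1) = 0 := apery2Term_eq_zero (by omega)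
      rw [h1, h4, h5]
      have hc := Nat.succ_mul_centralBinom_succ (n + 1)
      rw [Nat.centralBinom_eq_two_mul_choose, Nat.centralBinom_eq_two_mul_choose] at hc
      have e1 : (n + 2 + (n + 1 + 1)).choose (n + 1 + 1) = (2 * (n + 1 + 1)).choose (n + 1 + 1) := by
        congr 1; ring
      have e2 : (n + 1 + (n + 1)).choose (n + 1) = (2 * (n + 1)).choose (n + 1) := by
        congr 1; ring
      simp only [apery2Cert, apery2Term, Nat.choose_self, one_pow, one_mul, e1, e2]
      push_cast
      have hc' : ((n : ℤ) + 1 + 1) * ((2 * (n + 1 + 1)).choose (n + 1 + 1) : ℕ)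
          = 2 * (2 * ((n : ℤ) + 1) + 1) * ((2 * (n + 1)).choose (n + 1) : ℕ) := by
        exact_mod_cast hc
      linear_combination (-((n : ℤ) + 2)) * hc'
  · -- `k ≤ n`: every binomial is a rational multiple of `c = C(n+1,k+1)` and `d = C(n+2+k,k+1)`
    have hk : k ≤ n := by omega
    have r1 : (n + 2).choose (k + 1) * (n + 1 - k) = (n + 1).choose (k + 1) * (n + 2) := by
      have := Nat.choose_mul_succ_eq (n + 1) (k + 1)
      have e : n + 1 + 1 - (k + 1) = n + 1 - k := by omega
      rw [e] at this
      linarith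
    have r2 : n.choose (k + 1) * (n + 1) = (n + 1).choose (k + 1) * (n - k) := by
      have := Nat.choose_mul_succ_eq n (k + 1)
      have e : n + 1 - (k + 1) = n - k := by omega
      rw [e] at this
      exact this
    have r3 : (n + 1).choose k * (n + 1 - k) = (n + 1).choose (k + 1) * (k + 1) := by
      have := Nat.choose_succ_right_eq (n + 1) k
      linarith
    have r4 : (n + 1 + k).choose k * (n + 2 + k) = (n + 2 + k).choose (k + 1) * (k + 1) := by
      have := Nat.add_one_mul_choose_eq (n + 1 + k) k
      have e : n + 1 + k + 1 = n + 2 + k := by ring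
      rw [e] at this
      linarith
    have r5 : (n + 3 + k).choose (k + 1) * (n + 2) = (n + 2 + k).choose (k + 1) * (n + 3 + k) := by
      have := Nat.choose_mul_succ_eq (n + 2 + k) (k + 1)
      have e : n + 2 + k + 1 = n + 3 + k := by ring
      have e' : n + 3 + k - (k + 1) = n + 2 := by omega
      rw [e, e'] at this
      linarith
    have r6 : (n + 1 + k).choose (k + 1) * (n + 2 + k) = (n + 2 + k).choose (k + 1) * (n + 1) := by
      have := Nat.choose_mul_succ_eq (n + 1 + k) (k + 1)
      have e : n + 1 + k + 1 = n + 2 + k := by ring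
      have e' : n + 2 + k - (k + 1) = n + 1 := by omega
      rw [e, e'] at this
      linarith
    have hnk : ((n - k : ℕ) : ℚ) = (n : ℚ) - k := by push_cast [Nat.cast_sub hk]; ring
    have hnk1 : ((n + 1 - k : ℕ) : ℚ) = (n : ℚ) + 1 - k := by
      rw [Nat.cast_sub (by omega : k ≤ n + 1)]; push_cast; ring
    have q1 : (((n + 2).choose (k + 1) : ℕ) : ℚ) * ((n : ℚ) + 1 - k)
        = (((n + 1).choose (k + 1) : ℕ) : ℚ) * ((n : ℚ) + 2) := by
      rw [← hnk1]; exact_mod_cast r1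
    have q2 : ((n.choose (k + 1) : ℕ) : ℚ) * ((n : ℚ) + 1)
        = (((n + 1).choose (k + 1) : ℕ) : ℚ) * ((n : ℚ) - k) := by
      rw [← hnk]; exact_mod_cast r2
    have q3 : (((n + 1).choose k : ℕ) : ℚ) * ((n : ℚ) + 1 - k)
        = (((n + 1).choose (k + 1) : ℕ) : ℚ) * ((k : ℚ) + 1) := by
      rw [← hnk1]; exact_mod_cast r3
    have q4 : (((n + 1 + k).choose k : ℕ) : ℚ) * ((n : ℚ) + 2 + k)
        = (((n + 2 + k).choose (k + 1) : ℕ) : ℚ) * ((k : ℚ) + 1) := by exact_mod_cast r4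
    have q5 : (((n + 3 + k).choose (k + 1) : ℕ) : ℚ) * ((n : ℚ) + 2)
        = (((n + 2 + k).choose (k + 1) : ℕ) : ℚ) * ((n : ℚ) + 3 + k) := by exact_mod_cast r5
    have q6 : (((n + 1 + k).choose (k + 1) : ℕ) : ℚ) * ((n : ℚ) + 2 + k)
        = (((n + 2 + k).choose (k + 1) : ℕ) : ℚ) * ((n : ℚ) + 1) := by exact_mod_cast r6
    have d1 : (n : ℚ) + 1 - k ≠ 0 := by
      have : (k : ℚ) ≤ n := by exact_mod_cast hk
      linarith
    have d2 : (n : ℚ) + 1 ≠ 0 := by positivity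
    have d3 : (n : ℚ) + 2 + k ≠ 0 := by positivity
    have d4 : (n : ℚ) + 2 ≠ 0 := by positivity
    set c : ℚ := (((n + 1).choose (k + 1) : ℕ) : ℚ) with hc
    set d : ℚ := (((n + 2 + k).choose (k + 1) : ℕ) : ℚ) with hd
    have s1 : (((n + 2).choose (k + 1) : ℕ) : ℚ) = c * ((n : ℚ) + 2) / ((n : ℚ) + 1 - k) := by
      rw [eq_div_iff d1]; exact q1
    have s2 : ((n.choose (k + 1) : ℕ) : ℚ) = c * ((n : ℚ) - k) / ((n : ℚ) + 1) := by
      rw [eq_div_iff d2]; exact q2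
    have s3 : (((n + 1).choose k : ℕ) : ℚ) = c * ((k : ℚ) + 1) / ((n : ℚ) + 1 - k) := by
      rw [eq_div_iff d1]; exact q3
    have s4 : (((n + 1 + k).choose k : ℕ) : ℚ) = d * ((k : ℚ) + 1) / ((n : ℚ) + 2 + k) := by
      rw [eq_div_iff d3]; exact q4
    have s5 : (((n + 3 + k).choose (k + 1) : ℕ) : ℚ) = d * ((n : ℚ) + 3 + k) / ((n : ℚ) + 2) := by
      rw [eq_div_iff d4]; exact q5
    have s6 : (((n + 1 + k).choose (k + 1) : ℕ) : ℚ) = d * ((n : ℚ) + 1) / ((n : ℚ) + 2 + k) := by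
      rw [eq_div_iff d3]; exact q6
    have goal : ((apery2Cert (n + 1) (k + 1) - apery2Cert (n + 1) k : ℤ) : ℚ)
        = ((((n : ℤ) + 2) ^ 2 * (apery2Term (n + 2) (k + 1) : ℕ)
          - (apery2Mid n : ℕ) * (apery2Term (n + 1) (k + 1) : ℕ)
          - ((n : ℤ) + 1) ^ 2 * (apery2Term n (k + 1) : ℕ) : ℤ) : ℚ) := by
      have i1 : n + 2 + (k + 1) = n + 3 + k := by ring
      have i2 : n + 1 + (k + 1) = n + 2 + k := by ring
      have i3 : n + (k + 1) = n + 1 + k := by ring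
      simp only [apery2Cert, apery2Term, apery2Mid, i1, i2, i3]
      push_cast
      rw [s1, s2, s3, s4, s5, s6]
      field_simp
      ring
    exact_mod_cast goal

/-! ## Summation over `k` -/

/-- Summing the telescoped recurrence over `0 ≤ k ≤ K` collapses the certificate side to
`apery2Cert (n+1) K`. [cite: ChenXia2011, §1 (R-2)] -/
theorem apery2_sum_telescoped (n K : ℕ) :
    ∑ k ∈ range (K + 1), (((n : ℤ) + 2) ^ 2 * (apery2Term (n + 2) k : ℕ)
        - (apery2Mid n : ℕ) * (apery2Term (n + 1) k : ℕ) - ((n : ℤ) + 1) ^ 2 * (apery2Term n k : ℕ))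
      = apery2Cert (n + 1) K := by
  induction K with
  | zero => simp [apery2Cert_zero]
  | succ K ih => rw [sum_range_succ, ih, ← apery2Cert_succ_sub]; ring

/-- `Σ_{k ≤ n + j} F(n,k) = B_n`: terms beyond `k = n` vanish. [cite: ChenXia2011, §1 (definition of B_n)] -/
theorem sum_apery2Term_eq (n j : ℕ) : ∑ k ∈ range (n + j + 1), apery2Term n k = apery2Number n := by
  induction j with
  | zero => simp [apery2Number]
  | succ j ih =>
    rw [show n + (j + 1) + 1 = (n + j + 1) + 1 by ring, sum_range_succ, ih,
      apery2Term_eq_zero (by omega), add_zero]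

/-! ## The recurrence -/

/-- **Apéry's recurrence for `B_n`** ((R-2) at index `n+2`, subtraction-free in `ℕ`):
`(n+2)² B_{n+2} = (11n² + 33n + 25) B_{n+1} + (n+1)² B_n` for every `n : ℕ`.
[cite: ChenXia2011, §1 (R-2)] -/
theorem apery2Number_rec (n : ℕ) :
    (n + 2) ^ 2 * apery2Number (n + 2)
      = (11 * n ^ 2 + 33 * n + 25) * apery2Number (n + 1) + (n + 1) ^ 2 * apery2Number n := by
  have h := apery2_sum_telescoped n (n + 2)
  rw [apery2Cert_eq_zero (by omega : n + 1 < n + 2)] at h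
  rw [sum_sub_distrib, sum_sub_distrib] at h
  have e2 : ∑ k ∈ range (n + 2 + 1), ((n : ℤ) + 2) ^ 2 * (apery2Term (n + 2) k : ℕ)
      = ((n : ℤ) + 2) ^ 2 * (apery2Number (n + 2) : ℕ) := by
    rw [← mul_sum, ← sum_apery2Term_eq (n + 2) 0]
    push_cast
    rfl
  have e1 : ∑ k ∈ range (n + 2 + 1), ((apery2Mid n : ℕ) : ℤ) * (apery2Term (n + 1) k : ℕ)
      = (apery2Mid n : ℕ) * (apery2Number (n + 1) : ℕ) := by
    rw [← mul_sum, ← sum_apery2Term_eq (n + 1) 1]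
    push_cast
    rfl
  have e0 : ∑ k ∈ range (n + 2 + 1), ((n : ℤ) + 1) ^ 2 * (apery2Term n k : ℕ)
      = ((n : ℤ) + 1) ^ 2 * (apery2Number n : ℕ) := by
    rw [← mul_sum, ← sum_apery2Term_eq n 2]
    push_cast
    rfl
  rw [e2, e1, e0] at h
  simp only [apery2Mid] at h
  push_cast at h
  have hz : ((n : ℤ) + 2) ^ 2 * (apery2Number (n + 2) : ℕ)
      = (11 * (n : ℤ) ^ 2 + 33 * n + 25) * (apery2Number (n + 1) : ℕ)
        + ((n : ℤ) + 1) ^ 2 * (apery2Number n : ℕ) := by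
    linear_combination h
  exact_mod_cast hz

/-- **(R-2) verbatim**, cleared of denominators (in `ℤ`): for `n ≥ 2`,
`n² B_n = (11n² − 11n + 3) B_{n−1} + (n−1)² B_{n−2}`. [cite: ChenXia2011, §1 (R-2)] -/
theorem apery2Number_rec_R2 {n : ℕ} (hn : 2 ≤ n) :
    (n : ℤ) ^ 2 * (apery2Number n : ℕ)
      = (11 * (n : ℤ) ^ 2 - 11 * n + 3) * (apery2Number (n - 1) : ℕ)
        + ((n : ℤ) - 1) ^ 2 * (apery2Number (n - 2) : ℕ) := by
  obtain ⟨m, rfl⟩ : ∃ m, n = m + 2 := ⟨n - 2, by omega⟩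
  have h := apery2Number_rec m
  have hz : ((m : ℤ) + 2) ^ 2 * (apery2Number (m + 2) : ℕ)
      = (11 * (m : ℤ) ^ 2 + 33 * m + 25) * (apery2Number (m + 1) : ℕ)
        + ((m : ℤ) + 1) ^ 2 * (apery2Number m : ℕ) := by exact_mod_cast h
  simp only [Nat.add_sub_cancel, show m + 2 - 1 = m + 1 from rfl]
  push_cast
  linear_combination hz

end Literature.Combinatorics.Enumerative.AperyNumbersZetaTwo
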